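import Summits.ResolutionOfSingularities.ResolutionOfSingularities.Theorems.ConeCutLayers
import Literature.AlgebraicGeometry.Resolution.PointBlowupMohBound
import HarnessLib

/-!
# ConeCutLayersPoint — tree file 3/11: §A part 2 — the state-level cone law at a point round and the
restriction identities.  PROVED.

Content VERBATIM from the decomp-res lens-3 g15 file `HOME/decomp-res-lens-3/g15/parts/ConeCut-rev5-f76e5309.lean`
(sha256 f76e53096babc227…; CRITIC-LEDGER
rows 102/105/110/123 CLEARED, landing orders 15:53:15Z / 17:40:15Z).  HOME = run/shared/lean/pub/decomp-res.  Host: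
route `MaxContactCut`, aside
31770 `DefectWalksDeep` (and 31870) through the tree's lens-3 g14 `Theorems/FloorCut{Classes,Floor}` + `MaxContactCutFloorCut`.

[WRITER NOTE (decomp-res writer g6): per the lens's own landing instruction its §0 (l.130–876 = g14 `FloorCut`
VERBATIM) is DELETED and the
tree's `…Theorems.FloorCut` opened instead; §C⁵ `section AxisLaw` (l.2949–3086) is the tree's
`Theorems/ConeCutAxisLaw` (landed earlier,
opened here); the restated ProximityCut letters `LeavesNewest` / `StaysOnNewest` / `leavesNewest_iff_not_stays` /
`NoFreePointTailsDeep`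
(byte-identical to `Theorems/ProximityCutClasses`) are deleted and opened from the tree; the three class definitions
`IsTameFrom`,
`NoMixedTailsDeep`, `NoTameMixedTailsDeep` live in the cone-free `Theorems/ConeCutClasses` (so the route can import
the co-owned MIXED
aside).  Split: ConeCutClasses · ConeCutLayers / ConeCutLayersPoint (§A state level) · ConeCutWalks (§B) ·
ConeCutLawB (§C) · ConeCutRepeats
(§B⁺, §B⁺⁺⁺ part 1) · ConeCutLawE (§B⁺⁺⁺ part 2, LAW E) · ConeCutZigzag (§B⁺⁺
Fibonacci/zigzag, LAW C) · ConeCutLaws (all-repeat rigidity,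
LAW I, §D booking) · MaxContactCutConeCut / MaxContactCutConeCutCells (§D wiring to 31770/31870 BY NAME, Theses
cone).  ONE namespace
`…Theorems.ConeCut` as in the lens; global `set_option` lines dropped; nothing else changed.  `translate_ne_zero` is the Literature lemma
`PointBlowup.translate_ne_zero` (PointBlowupMohBound), copy deleted.]
(Sources: Hauser2010 §§D,F,G; HauserPerlega2019; Moh1987; CossartPiltant2019; CossartJannsenSaito2020 Thm. 2.14,
§§5,9; BenitoVillamayor2013 §7; CasasAlvero2000 Ch. 3; BierstoneGrigorievMilmanWlodarczyk2011 Def. 3.1.3.)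
-/

noncomputable section

open MvPolynomial Finset
open Literature.AlgebraicGeometry.Resolution
open Literature.AlgebraicGeometry.Resolution.Hauser2010
open Literature.AlgebraicGeometry.Resolution.PointBlowup
open Summit.ResolutionOfSingularities.ResolutionOfSingularities.Theorems.TightDefectClasses
open Summit.ResolutionOfSingularities.ResolutionOfSingularities.Theorems.TightDefectStrongWalks
open Summit.ResolutionOfSingularities.ResolutionOfSingularities.Theorems.ItineraryCutClasses
open Summit.ResolutionOfSingularities.ResolutionOfSingularities.Theorems.BoundaryLedger
open Literature.AlgebraicGeometry.Resolution.WeightedBlowup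
open Literature.Barriers.ResolutionOfSingularities
open Summit.ResolutionOfSingularities.ResolutionOfSingularities.Theorems.FloorCut
open Summit.ResolutionOfSingularities.ResolutionOfSingularities.Theorems.ConeCutAxisLaw
open Summit.ResolutionOfSingularities.ResolutionOfSingularities.Theorems.ProximityCut (NoOriginTails LeavesNewest StaysOnNewest)
open Summit.ResolutionOfSingularities.ResolutionOfSingularities.Theorems.ProximityCut (leavesNewest_iff_not_stays NoFreePointTailsDeep)

namespace Summit.ResolutionOfSingularities.ResolutionOfSingularities.Theorems.ConeCut

section StateLevel

variable {σ : Type*} {K : Type*} [Field K] [Fintype σ] [DecidableEq σ] [DecidableEq K]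

/-- **THE CONE LAW (state level, PROVED).**  Let `s` be a state with `u^r ∣ F`, order `q < o < 2q`, and let `(j,b)` be
an equimultiple point whose next state has order `o' < 2q` with the PLATEAU LEDGER `o' = (o − |r|) + κ + (o − q)`
(`κ` = kept mass).  Then the translated residual layer `N = translate b M` is a NON-ZERO FORM OF DEGREE EXACTLY
`o − |r|` (the shade): the residual tangent cone is `h(u_i − b_i u_j : i ≠ j)`, a cone with vertex the centre
direction. [new] [folklore] -/
theorem cone_law {q : ℕ} (hq : 0 < q) (j : σ) (b : σ → K) (hbj : b j = 0) (s : State σ K)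
    (hr : ∀ d ∈ s.F.support, s.r ≤ d) (hequi : IsEquimultiplePoint q j b s) {o o' : ℕ} (ho : ordZero s.F = o)
    (hqo : q < o) (ho2 : o < 2 * q) (ho' : ordZero (step q j b s).F = o') (ho'2 : o' < 2 * q)
    (hled : o' = (o - s.r.degree) + ((s.r.filter (fun i => b i = 0)).erase j).degree + (o - q)) :
    (translate b (resLayer j s o)).IsHomogeneous (o - s.r.degree) ∧ translate b (resLayer j s o) ≠ 0 := by
  classical
  set N := translate b (resLayer j s o) with hN
  set T := translate b (monomial (s.r.update j 0) (1 : K)) with hT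
  have hN0 : N ≠ 0 := PointBlowup.translate_ne_zero b (resLayer_ne_zero j s hr ho)
  refine ⟨?_, hN0⟩
  -- orders
  have hLN : translate b (initLayer j s.F o) = T * N := by
    rw [initLayer_eq_mul j s hr o, hT, hN]
    unfold PointBlowup.translate
    rw [map_mul]
  have hordL := le_ordZero_translate_initLayer hq j b hbj s hequi hqo ho2 ho' ho'2
  rw [hLN, ordZero_mul] at hordL
  have hordT := ordZero_translate_boundary_le j b hbj s.r
  obtain ⟨n, hn⟩ := exists_ordZero_eq_natCast hN0
  have hT0 : T ≠ 0 := by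
    intro h
    have := coeff_translate_boundary j b hbj s.r
    rw [← hT, h, coeff_zero] at this
    exact absurd this.symm (Finset.prod_ne_zero_iff.mpr fun i _ => by
      split_ifs with h'
      · exact one_ne_zero
      · exact pow_ne_zero _ h')
  obtain ⟨m, hm⟩ := exists_ordZero_eq_natCast hT0
  rw [hn, hm] at hordL
  rw [hm] at hordT
  have h1 : o' - (o - q) ≤ m + n := by exact_mod_cast hordL
  have h2 : m ≤ ((s.r.filter (fun i => b i = 0)).erase j).degree := by exact_mod_cast hordT
  have hsn : o - s.r.degree ≤ n := by omega
  -- homogeneity: every monomial of `N` has degree `≤ o − |r|` and `≥ n ≥ o − |r|`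
  intro E hE
  have hup := degree_le_of_coeff_translate_resLayer_ne_zero j b s hr o hE
  have hlow : n ≤ E.degree := by
    by_contra hlt
    exact hE (coeff_eq_zero_of_degree_lt_ordZero (by rw [hn]; exact_mod_cast (not_le.mp hlt)))
  have hw : Finsupp.weight (1 : σ → ℕ) E = E.degree := by rw [Finsupp.degree_eq_weight_one]; rfl
  rw [hw]
  omega

omit [DecidableEq K] in
/-- The translated residual layer does not involve `u_j` (when `b_j = 0`). [folklore] -/
theorem coeff_translate_resLayer_eq_zero (j : σ) (b : σ → K) (s : State σ K) (o : ℕ)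
    {E : σ →₀ ℕ} (hEj : E j ≠ 0) : coeff E (translate b (resLayer j s o)) = 0 := by
  classical
  unfold resLayer
  rw [translate_finset_sum, coeff_sum]
  refine Finset.sum_eq_zero fun d _ => coeff_translate_monomial_eq_zero_of_lt b _ _ _ (i := j) ?_
  rw [update_apply', if_pos rfl]
  exact Nat.pos_of_ne_zero hEj

omit [DecidableEq K] in
/-- Exponents of the residual layer determine the monomial of `F` (same degree, `u^r ∣ F`). [folklore] -/
theorem eq_of_resLayer_exponent_eq (j : σ) (s : State σ K) (hr : ∀ d ∈ s.F.support, s.r ≤ d) {d d' : σ →₀ ℕ}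
    (hd : d ∈ s.F.support) (hd' : d' ∈ s.F.support) (hdeg : d'.degree = d.degree)
    (heq : (d' - s.r).update j 0 = (d - s.r).update j 0) : d' = d := by
  have h1 : ∀ k, k ≠ j → d' k = d k := by
    intro k hk
    have := DFunLike.congr_fun heq k
    rw [update_apply', update_apply', if_neg hk, if_neg hk, Finsupp.tsub_apply, Finsupp.tsub_apply] at this
    have h3 := Finsupp.le_def.mp (hr d hd) k
    have h4 := Finsupp.le_def.mp (hr d' hd') k
    omega
  ext k
  by_cases hk : k = j
  · subst hk
    have e1 := degree_eq_add_sum_erase k d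
    have e2 := degree_eq_add_sum_erase k d'
    have e3 : ∑ i ∈ univ.erase k, d' i = ∑ i ∈ univ.erase k, d i :=
      Finset.sum_congr rfl fun i hi => h1 i (Finset.ne_of_mem_erase hi)
    omega
  · exact h1 k hk

omit [DecidableEq K] in
/-- **Coefficients of the residual layer** are those of `F` shifted by the boundary: `coeff_{m[j↦0]} M = c_{r+m}` for
`|m| = o − |r|`. [folklore] -/
theorem coeff_resLayer (j : σ) (s : State σ K) (hr : ∀ d ∈ s.F.support, s.r ≤ d) (o : ℕ) (m : σ →₀ ℕ)
    (hm : m.degree + s.r.degree = o) : coeff (m.update j 0) (resLayer j s o) = coeff (s.r + m) s.F := by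
  classical
  unfold resLayer
  rw [coeff_sum, Finset.sum_eq_single (s.r + m)]
  · rw [coeff_monomial, add_tsub_cancel_left, if_pos rfl]
  · intro d hd hne
    rw [coeff_monomial, if_neg]
    intro heq
    obtain ⟨hdF, hdo⟩ := Finset.mem_filter.mp hd
    by_cases hmem : s.r + m ∈ s.F.support
    · refine hne (eq_of_resLayer_exponent_eq j s hr hmem hdF ?_ ?_)
      · rw [hdo, map_add]; omega
      · rw [heq, add_tsub_cancel_left]
    · -- then `d` would have the exponent of `r + m` without being it: compare entrywise
      apply hne
      have h1 : ∀ k, k ≠ j → d k = (s.r + m) k := by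
        intro k hk
        have := DFunLike.congr_fun heq k
        rw [update_apply', update_apply', if_neg hk, if_neg hk, Finsupp.tsub_apply] at this
        have h3 := Finsupp.le_def.mp (hr d hdF) k
        rw [Finsupp.add_apply]
        omega
      ext k
      by_cases hk : k = j
      · subst hk
        have e1 := degree_eq_add_sum_erase k d
        have e2 := degree_eq_add_sum_erase k (s.r + m)
        have e3 : ∑ i ∈ univ.erase k, d i = ∑ i ∈ univ.erase k, (s.r + m) i :=
          Finset.sum_congr rfl fun i hi => h1 i (Finset.ne_of_mem_erase hi)
        have e4 : (s.r + m).degree = o := by rw [map_add]; omega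
        omega
      · exact h1 k hk
  · intro h
    have h0 : coeff (s.r + m) s.F = 0 := by
      by_contra hne
      exact h (Finset.mem_filter.mpr ⟨MvPolynomial.mem_support_iff.mpr hne, by rw [map_add]; omega⟩)
    rw [h0, map_zero, coeff_zero]

omit [DecidableEq K] in
/-- A monomial in variables where `b` vanishes is fixed by the translation. [folklore] -/
theorem translate_monomial_eq_self (b : σ → K) (E : σ →₀ ℕ) (h : ∀ l, E l ≠ 0 → b l = 0) :
    translate b (monomial E (1 : K)) = monomial E 1 := by
  classical
  ext D
  rw [coeff_translate_monomial, one_mul, coeff_monomial]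
  by_cases hDE : E = D
  · rw [if_pos hDE, ← hDE]
    refine Finset.prod_eq_one fun l _ => ?_
    simp
  · rw [if_neg hDE]
    obtain ⟨l, hl⟩ : ∃ l, E l ≠ D l := by
      by_contra hall
      push Not at hall
      exact hDE (Finsupp.ext hall)
    refine Finset.prod_eq_zero (Finset.mem_univ l) ?_
    rcases lt_or_gt_of_ne hl with hlt | hgt
    · rw [Nat.choose_eq_zero_of_lt hlt, Nat.cast_zero, zero_mul]
    · have hb : b l = 0 := h l (by omega)
      rw [hb, zero_pow (by omega), mul_zero]

/-- **BOUNDARY SPLIT (PROVED)**: the translated boundary monomial is the KEPT monomial times a polynomial with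
non-zero constant term: `∏_{l≠j}(u_l + b_l)^{r_l} = u^{kept} · U`, `U(0) = ∏_{b_l ≠ 0} b_l^{r_l}`. [folklore] -/
theorem translate_boundary_split (j : σ) (b : σ → K) (hbj : b j = 0) (r : σ →₀ ℕ) :
    translate b (monomial (r.update j 0) (1 : K)) =
      monomial ((r.filter (fun l => b l = 0)).erase j) 1 * translate b (monomial (r.filter (fun l => b l ≠ 0)) 1) := by
  classical
  have hexp : r.update j 0 = (r.filter (fun l => b l = 0)).erase j + r.filter (fun l => b l ≠ 0) := by
    ext l
    rw [update_apply', Finsupp.add_apply, Finsupp.filter_apply]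
    by_cases hlj : l = j
    · subst hlj
      rw [if_pos rfl, Finsupp.erase_same, if_neg (fun h => h hbj)]
      simp
    · rw [if_neg hlj, Finsupp.erase_ne hlj, Finsupp.filter_apply]
      by_cases hbl : b l = 0
      · rw [if_pos hbl, if_neg (fun h => h hbl), add_zero]
      · rw [if_neg hbl, if_pos hbl, zero_add]
  rw [hexp, ← translate_monomial_eq_self b ((r.filter (fun l => b l = 0)).erase j) (fun l hl => ?_)]
  · rw [show monomial ((r.filter (fun l => b l = 0)).erase j + r.filter (fun l => b l ≠ 0)) (1 : K) =
        monomial ((r.filter (fun l => b l = 0)).erase j) 1 * monomial (r.filter (fun l => b l ≠ 0)) 1 by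
      rw [monomial_mul, one_mul]]
    unfold PointBlowup.translate
    rw [map_mul]
  · by_cases hlj : l = j
    · rw [hlj]; exact hbj
    · rw [Finsupp.erase_ne hlj, Finsupp.filter_apply] at hl
      by_contra hb
      rw [if_neg hb] at hl
      exact hl rfl

/-- … and the cofactor `U` has the non-zero constant term `∏_{b_l ≠ 0} b_l^{r_l}`. [folklore] -/
theorem coeff_zero_translate_boundary_ne_zero (b : σ → K) (r : σ →₀ ℕ) :
    coeff 0 (translate b (monomial (r.filter (fun l => b l ≠ 0)) (1 : K))) ≠ 0 := by
  classical
  rw [coeff_translate_monomial, one_mul]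
  refine Finset.prod_ne_zero_iff.mpr fun l _ => ?_
  rw [Finsupp.zero_apply, Nat.choose_zero_right, Nat.cast_one, one_mul, Nat.sub_zero, Finsupp.filter_apply]
  split_ifs with h
  · exact pow_ne_zero _ h
  · rw [pow_zero]; exact one_ne_zero

omit [DecidableEq K] [Fintype σ] in
/-- **Lowest layer of `U · N` for a form `N`**: `coeff_m (U N) = U(0) · coeff_m N` when `|m| = deg N`. [folklore] -/
theorem coeff_mul_of_isHomogeneous (U N : MvPolynomial σ K) {n : ℕ} (hN : N.IsHomogeneous n) (m : σ →₀ ℕ)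
    (hm : m.degree = n) : coeff m (U * N) = coeff 0 U * coeff m N := by
  classical
  rw [coeff_mul, Finset.sum_eq_single ((0 : σ →₀ ℕ), m)]
  · intro x hx hne
    by_cases hc : coeff x.2 N = 0
    · rw [hc, mul_zero]
    · exfalso
      have hdeg : x.2.degree = n := by
        by_contra h
        exact hc (hN.coeff_eq_zero h)
      have hsum : x.1 + x.2 = m := Finset.HasAntidiagonal.mem_antidiagonal.mp hx
      have hd := congrArg Finsupp.degree hsum
      rw [map_add] at hd
      have h1 : x.1 = 0 := (Finsupp.degree_eq_zero_iff _).mp (by omega)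
      rw [h1, zero_add] at hsum
      exact hne (Prod.ext h1 hsum)
  · intro h
    exact absurd (Finset.HasAntidiagonal.mem_antidiagonal.mpr (by rw [zero_add])) h

/-- **THE NEXT STATE'S `u_j^{o−q}`-LAYER (PROVED)**: for `E_j = 0`, `coeff_{E + (o−q)e_j} F⁺ = coeff_E (translate b L)`
— cleaning does not touch this layer since `0 < o − q < q`. [new] [folklore] -/
theorem coeff_step_layer {q : ℕ} (j : σ) (b : σ → K) (hbj : b j = 0) (s : State σ K) {o : ℕ} (hqo : q < o)
    (ho2 : o < 2 * q) {E : σ →₀ ℕ} (hEj : E j = 0) :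
    coeff (E + Finsupp.single j (o - q)) (step q j b s).F = coeff E (translate b (initLayer j s.F o)) := by
  classical
  have hstep : (step q j b s).F = deletePthPowers q (pointTransform q j b s) := rfl
  rw [hstep, coeff_deletePthPowers]
  have hDj : (E + Finsupp.single j (o - q)) j = o - q := by
    rw [Finsupp.add_apply, hEj, Finsupp.single_eq_same, zero_add]
  split_ifs with hP
  · exfalso
    have := (isPthPowerExponent_iff q _).mp hP j
    rw [hDj] at this
    have := Nat.le_of_dvd (by omega) this
    omega
  · rw [coeff_pointTransform_layer q j b hbj s hqo hDj]
    congr 1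
    ext k
    rw [update_apply', Finsupp.add_apply, Finsupp.single_apply]
    split_ifs with h1 h2
    · rw [h1, hEj]
    · exact absurd h2.symm h1
    · omega

/-- **THE RESTRICTION IDENTITY (state level, PROVED).**  Under the hypotheses of the cone law, the `u_j`-free part of
the next residual cone is the residual form up to a unit: for `m_j = 0`, `|m| = o − |r|`,
`coeff_{kept + m + (o−q)e_j} F⁺ = U(0) · coeff_m N`. [new] [folklore] -/
theorem restriction_identity {q : ℕ} (hq : 0 < q) (j : σ) (b : σ → K) (hbj : b j = 0) (s : State σ K)
    (hr : ∀ d ∈ s.F.support, s.r ≤ d) (hequi : IsEquimultiplePoint q j b s) {o o' : ℕ} (ho : ordZero s.F = o)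
    (hqo : q < o) (ho2 : o < 2 * q) (ho' : ordZero (step q j b s).F = o') (ho'2 : o' < 2 * q)
    (hled : o' = (o - s.r.degree) + ((s.r.filter (fun i => b i = 0)).erase j).degree + (o - q))
    (m : σ →₀ ℕ) (hmj : m j = 0) (hm : m.degree = o - s.r.degree) :
    coeff ((s.r.filter (fun i => b i = 0)).erase j + m + Finsupp.single j (o - q)) (step q j b s).F =
      coeff 0 (translate b (monomial (s.r.filter (fun l => b l ≠ 0)) (1 : K))) * coeff m (translate b (resLayer j s o)) := by
  classical
  have hN := (cone_law hq j b hbj s hr hequi ho hqo ho2 ho' ho'2 hled).1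
  have hEj : ((s.r.filter (fun i => b i = 0)).erase j + m) j = 0 := by
    rw [Finsupp.add_apply, Finsupp.erase_same, hmj]
  rw [coeff_step_layer j b hbj s hqo ho2 hEj, initLayer_eq_mul j s hr o,
    show PointBlowup.translate b (monomial (s.r.update j 0) 1 * resLayer j s o) =
      PointBlowup.translate b (monomial (s.r.update j 0) 1) * PointBlowup.translate b (resLayer j s o)
      from map_mul _ _ _,
    translate_boundary_split j b hbj s.r, mul_assoc, coeff_monomial_mul, one_mul,
    coeff_mul_of_isHomogeneous _ _ hN m hm]

end StateLevel

end Summit.ResolutionOfSingularities.ResolutionOfSingularities.Theorems.ConeCut
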